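import Summits.HodgeConjecture.HodgeConjecture.Theorems.CurveNetMordellWeilVerticalSupportMiddleChowDegenerate

/-!
# Birth skeleton (BC3) of piece P₁ `HodgeFourfoldsChowDegenerate` — HC(4;2,2) for CH₀-degenerate fourfolds
(crux-strategist BC2 redirect of `VerticalSupportMiddle`, stmt-HodgeConjecture-2782, unit cstrat-stmt-HodgeConjecture-2782-r1,
2026-08-17; to be re-registered against the child item `CurveNetMordellWeil.HodgeFourfoldsChowDegenerate` once the
split lands — replace the local `abbrev` by the route decl, same proof)

P₁ is a THEOREM granted a Gysin / cycle-class formalism with Hodge-compatible Gysin morphisms (landed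
`hodgeConjectureFor_of_chowZeroDegenerate_fourfold_of_gysin`: Conte–Murre 1978 / Bloch–Srinivas 1983 / Voisin II
Prop. 10.26 at `q = 2`, the induction hypothesis `hodgeBelowDim_four` being a theorem). The formalism exists granted
exactly the two named facts of the live lead's skeleton on the parent crux (line `regime-split-middle-step`, lead c2):
Fulton's degree formula for the complex orientations and the spanning of the top Hodge classes of `(d+1)`-folds by
pull-backs (whence Voisin II Lemma 9.18). Those two facts are this birth's stubs; the composition is the landed
`middleStepChowDegenerate_of_degreeFormula_of_spanning` at `q = 2`.
-/

noncomputable section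

set_option linter.dupNamespace false

open CategoryTheory AlgebraicGeometry
open Literature.AlgebraicGeometry Literature.AlgebraicGeometry.Motives
  Literature.AlgebraicGeometry.HodgeTheory Literature.AlgebraicTopology.SingularHomology
open Summit.HodgeConjecture.HodgeConjecture.Theorems
open Summit.HodgeConjecture.HodgeConjecture.Theorems.RegimeSplit

namespace Summit.HodgeConjecture.HodgeConjecture.Cruxes.VerticalSupportMiddle.LevelRegimeSplit.P1Birth

/-- The piece (local copy, verbatim the text of the future route item `CurveNetMordellWeil.HodgeFourfoldsChowDegenerate`). -/
abbrev HodgeFourfoldsChowDegenerate : Prop :=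
  ∀ ⦃X : Literature.AlgebraicGeometry.Motives.SchemeOver ℂ⦄, Literature.AlgebraicGeometry.Motives.IsSmoothProjective 4 X → (∃ W : Set X.left, IsClosed W ∧ W ≠ Set.univ ∧ ∀ z ∈ Literature.AlgebraicGeometry.Motives.cyclesOfDim X.left 0, ∃ z' ∈ Literature.AlgebraicGeometry.Motives.cyclesOfDim X.left 0, (∀ x, z' x ≠ 0 → x ∈ W) ∧ Literature.AlgebraicGeometry.Motives.IsRationallyEquivalent z z' 0) → ∀ c : Literature.AlgebraicGeometry.HodgeTheory.complexBetti X (2 * 2), Literature.AlgebraicGeometry.HodgeTheory.IsRationalClass c → Literature.AlgebraicGeometry.HodgeTheory.IsOfHodgeType 4 X (2 * 2) 2 2 c → c ∈ Literature.AlgebraicGeometry.HodgeTheory.algebraicClasses X 2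

/-! ### Stubs (the two named literature debts) -/

/-- **Stub 1: Fulton's degree formula for the complex orientations** (Fulton, Intersection Theory, Lemma 19.1.2 /
Ex. 19.1.?): `f_* f^* = deg f · id` in top degree for generically finite surjections of smooth projective varieties,
for the Gysin maps `complexGysin` of the complex orientation family. Named fact of the tree
(`Fulton1998_degreeFormula_complexOrientation`), claimed by prover-pitem-stmt-HodgeConjecture-3003 (approach: general
fibres + resolving the rational map). [size L] [cite: Fulton1998, Lemma 19.1.2] -/
theorem stub_degreeFormula : Fulton1998_degreeFormula_complexOrientation := by
  sorry

/-- **Stub 2: the rational `(d,d)`-classes of a smooth projective `(d+1)`-fold are spanned by pull-backs of the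
hyperplane-power classes along finite projections / embeddings** (`topHodgeClasses_spanned_by_pullbacks`; with stub 1 it
yields Voisin II Lemma 9.18 for the complex orientations,
`Voisin2003_cycleClass_div_eq_zero_complexOrientation_of_degreeFormula_of_spanning`). Named fact of the tree, cut into
six sub-stubs by lead c2 (A, C, E1, P1, G4, assembly; A/C/E1/P1 landed). [size L]
[cite: VoisinHodgeI2002, Thm. 6.25 and Thm. 11.30] [cite: VoisinHodgeII2003, Lemma 9.18] -/
theorem stub_spanning : topHodgeClasses_spanned_by_pullbacks := by
  sorry

/-! ### Composition -/

/-- **BIRTH COMPOSITION: the two debts → the piece `HodgeFourfoldsChowDegenerate`**, through the landed CH₀-degenerate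
regime of the middle step (`middleStepChowDegenerate_of_degreeFormula_of_spanning`) at `q = 2` with the free induction
hypothesis `hodgeBelowDim_four`. [cite: VoisinHodgeII2003, Prop. 10.26] [cite: ConteMurre1978] [cite: BlochSrinivas1983] -/
theorem HodgeFourfoldsChowDegenerate_of :
    Fulton1998_degreeFormula_complexOrientation → topHodgeClasses_spanned_by_pullbacks → HodgeFourfoldsChowDegenerate :=
  fun hB hS _ hX hW c hc hh ↦
    middleStepChowDegenerate_of_degreeFormula_of_spanning hB hS le_rfl hX hodgeBelowDim_four hW c hc hh

/-- The piece, closed modulo exactly the two stubs. -/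
theorem HodgeFourfoldsChowDegenerate_of_stubs : HodgeFourfoldsChowDegenerate :=
  HodgeFourfoldsChowDegenerate_of stub_degreeFormula stub_spanning

/-! ### Sanity -/

/-- The piece granted ANY Gysin formalism with Hodge-compatible Gysin morphisms (the structural form of the debts).
[cite: VoisinHodgeII2003, Prop. 10.26] -/
theorem hodgeFourfoldsChowDegenerate_of_gysin (G : GysinFormalism) (hG : G.IsGysinHodgeCompatible) :
    HodgeFourfoldsChowDegenerate :=
  fun _ hX hW c hc hh ↦ (hodgeConjectureFor_of_chowZeroDegenerate_fourfold_of_gysin G hG hX hW).2 2 c hc hh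

/-- The piece is HC-true. [cite: Deligne2000, §1] -/
theorem hodgeFourfoldsChowDegenerate_of_hodgeConjecture (h : _root_.HodgeConjecture) : HodgeFourfoldsChowDegenerate :=
  fun _ hX _ c hc hh ↦ (h hX).2 2 c hc hh

end Summit.HodgeConjecture.HodgeConjecture.Cruxes.VerticalSupportMiddle.LevelRegimeSplit.P1Birth

end
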